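import Mathlib
import Summits.NavierStokesRegularity.FluidComputer.BorderedResolventFredholm
import Summits.NavierStokesRegularity.FluidComputer.BorderedHeadTailBound

/-!
# THEOREM 3-B (c)/(d) in resolvent coordinates: simplicity and ISOLATION of the certified eigenvalue from the a-priori bound, via the pencil form of K-B1–K-B3 and the Fredholm alternative (profile-cert-3 g4, cell `ns-blowup`, 2026-08-26)

HONEST FRAMING (human rulings D-0035/D-0074): nothing here is a claim about Navier–Stokes blow-up.
WHAT THIS IS NOT: not NS evidence. Abstract algebra / Hilbert-space theorems; their consumer is
THEOREM 3-B of `instab/CERT-ROPE-X0.md` (REFEREE A19 PASS) for the MODEL operator «forced NS linearised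
about abc(1,1,1)», i.e. the «ALGEBRAICALLY SIMPLE» and «σ(L|class) ∩ {|z − λ⋆| < r_iso} = {λ⋆}» clauses
printed by every F5 eigenpair row of GROUP B (`CertificateAbcSpectrum*`). Third file of the seat's
series: `BorderedResolventFredholm` (unit + compact ⇒ invertible; the bordered inverse `S`, `‖S‖ ≤ M`),
`BorderedHeadTailBound` (the a-priori bound from head/tail data; its transfer under perturbations).

RESOLVENT COORDINATES (instab4 `SkewCutGalerkin*`): `L = L₀ + A`, `S₀ = (x₀ − L₀)⁻¹` compact and
injective, `T = A S₀`, `D(L) = range S₀`, `(z − L)(S₀ y) = R_z y` with the LINEAR PENCIL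
`R_z = N + z S₀`, `N := 1 − T − x₀ S₀` (so `R_z = 1 − T − (x₀ − z) S₀`). Eigenvectors of `L` at `z` are
`S₀ y` with `R_z y = 0`; a Jordan chain `(L − λ)u₁ ∈ span{v⋆} ∖ 0` reads `R_λ y₁ = c • S₀ w⋆`.

* §1 PENCIL FORM OF K-B1–K-B3, K-B5 (pure algebra, any field, `N, J : E → F`, `R_λ w⋆ = 0`, bordered
  map `(y, μ) ↦ (R_z y + μ • J w⋆, φ y)` injective): `pencil_eq_smul` (K-B1′: `ker R_λ ⊆ span{w⋆}`),
  `pencil_ne_base` / `pencil_chain_eq_zero` (K-B2′: no `y` with `R_λ y = J w⋆`; a chain `R_λ y₁ = J y₂`,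
  `R_λ y₂ = 0` forces `y₂ = 0` — ALGEBRAIC SIMPLICITY, no compactness), `pencil_eq_zero_of_ne` (K-B3′),
  `pencil_bordered_iff_eigen` (K-B5′: the bordered equation at the float datum holds iff `R_l w = 0`).
  They replace the instantiation `E := C^∞ ∩ H` of REFEREE note P-A19-3 (K-B1–K-B3 need an endomorphism).
* §2 ANALYTIC ASSEMBLY over `𝕜 = ℝ, ℂ`: from the A-PRIORI BOUND at the float pair,
  `‖(S₀ y, μ)‖ ≤ M‖(R_λ̃ y + μṽ, ⟪ṽ, S₀ y⟫)‖` (= 3-B (a), `BorderedHeadTailBound`), a certified pair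
  `(λ⋆, w⋆)`, `R_λ⋆ w⋆ = 0`, within `ρ` of `(λ̃, ṽ)` in the `ℓ²` pairing (`‖S₀w⋆ − ṽ‖² + |λ⋆ − λ̃|² ≤ ρ²`,
  the output of K-B4/K-B5) and `Mρ < 1`:
  `apriori_bound_at_certified` (the bound transfers to the bordered map at `(λ⋆, S₀ w⋆)` with
  `M⋆ = M/(1 − Mρ)`; Cauchy–Schwarz gives `δ = ρ` ≤ the note's `√2ρ`), `bordered_injective_at` (at every
  `z` with `M⋆|z − λ⋆| < 1`), `simple_of_apriori` (3-B (c)), and **`isUnit_resolventCoord_of_near`**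
  (3-B (d)): for `0 < |z − λ⋆| < (1 − Mρ)/M` the operator `R_z` is INVERTIBLE (Fredholm alternative,
  `BorderedResolventFredholm`) — «`z ∈ ρ(L)`»; the printed `r_iso = (1 − κ)/M`, `κ = √2Mρ ≥ Mρ`, is
  covered (`isUnit_resolventCoord_of_lt_rIso`).

Mathlib + the two companions; no new definitions. bears_on LADDER-NS N5 / Z4-a(1)(2) (F5 certificate
rigour); evidence-only for route item `EpisodeBase` (stmt-NavierStokesRegularity-19179).
-/

open scoped InnerProductSpace

namespace Summit.NavierStokesRegularity.FluidComputer.BorderedResolventIsolation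

/-! ## §1 The pencil form of K-B1–K-B3 and K-B5 (pure algebra) -/

section Pencil

variable {𝕜 : Type*} [Field 𝕜] {E F : Type*} [AddCommGroup E] [Module 𝕜 E] [AddCommGroup F]
  [Module 𝕜 F]
variable (N J : E →ₗ[𝕜] F) (φ : E →ₗ[𝕜] 𝕜) (ws : E) (z lam : 𝕜)

/-- Bordered injectivity of the pencil at any `z` forces `J w⋆ ≠ 0` (test the pair `(0, 1)`). -/
theorem pencil_base_ne_zero
    (hinj : ∀ (y : E) (μ : 𝕜), N y + z • J y + μ • J ws = 0 → φ y = 0 → y = 0 ∧ μ = 0) :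
    J ws ≠ 0 := by
  intro h0
  have h := hinj 0 1 (by simp [h0]) (by simp)
  exact one_ne_zero h.2

/-- Bordered injectivity at the eigen-parameter `lam` of `w⋆` (`R_λ w⋆ = 0`) forces `φ w⋆ ≠ 0`
(test the pair `(w⋆, 0)`). -/
theorem pencil_functional_ne_zero (hws : N ws + lam • J ws = 0)
    (hinj : ∀ (y : E) (μ : 𝕜), N y + lam • J y + μ • J ws = 0 → φ y = 0 → y = 0 ∧ μ = 0) :
    φ ws ≠ 0 := by
  intro hφ
  have h := hinj ws 0 (by rw [hws, zero_smul, add_zero]) hφ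
  exact pencil_base_ne_zero N J φ ws lam hinj (by rw [h.1, map_zero])

/-- **K-B1′ (geometric multiplicity one, pencil form).** If `R_λ w⋆ = 0` and the bordered pencil map
at `lam` is injective, every `y` with `R_λ y = 0` is the multiple `(φ y / φ w⋆) • w⋆`. [folklore] -/
theorem pencil_eq_smul (hws : N ws + lam • J ws = 0)
    (hinj : ∀ (y : E) (μ : 𝕜), N y + lam • J y + μ • J ws = 0 → φ y = 0 → y = 0 ∧ μ = 0)
    (y : E) (hy : N y + lam • J y = 0) :
    y = (φ y / φ ws) • ws := by
  have hφ : φ ws ≠ 0 := pencil_functional_ne_zero N J φ ws lam hws hinj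
  set c : 𝕜 := φ y / φ ws with hc
  have h1 : N (y - c • ws) + lam • J (y - c • ws) + (0 : 𝕜) • J ws = 0 := by
    have : N (y - c • ws) + lam • J (y - c • ws) = (N y + lam • J y) - c • (N ws + lam • J ws) := by
      simp only [map_sub, map_smul]
      module
    rw [this, hy, hws, smul_zero, sub_zero, zero_smul, add_zero]
  have h2 : φ (y - c • ws) = 0 := by
    simp only [map_sub, map_smul, smul_eq_mul, hc]
    field_simp
    ring
  exact sub_eq_zero.mp (hinj _ 0 h1 h2).1

/-- **K-B2′ (no Jordan chain, pencil form).** If `R_λ w⋆ = 0` and the bordered pencil map at `lam`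
is injective, there is no `y` with `R_λ y = J w⋆` (`v⋆ = S₀ w⋆ ∉ range(λ⋆ − L)`). [folklore] -/
theorem pencil_ne_base (hws : N ws + lam • J ws = 0)
    (hinj : ∀ (y : E) (μ : 𝕜), N y + lam • J y + μ • J ws = 0 → φ y = 0 → y = 0 ∧ μ = 0)
    (y : E) : N y + lam • J y ≠ J ws := by
  intro hy
  have hφ : φ ws ≠ 0 := pencil_functional_ne_zero N J φ ws lam hws hinj
  set c : 𝕜 := φ y / φ ws with hc
  have h1 : N (y - c • ws) + lam • J (y - c • ws) + (-1 : 𝕜) • J ws = 0 := by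
    have : N (y - c • ws) + lam • J (y - c • ws) = (N y + lam • J y) - c • (N ws + lam • J ws) := by
      simp only [map_sub, map_smul]
      module
    rw [this, hy, hws, smul_zero, sub_zero, neg_one_smul, add_neg_cancel]
  have h2 : φ (y - c • ws) = 0 := by
    simp only [map_sub, map_smul, smul_eq_mul, hc]
    field_simp
    ring
  exact (neg_ne_zero.mpr one_ne_zero) (hinj _ (-1) h1 h2).2

/-- **K-B2″ (algebraic multiplicity one, pencil form).** A rank-two chain `R_λ y₁ = J y₂`, `R_λ y₂ = 0`
forces `y₂ = 0` (hence `R_λ y₁ = 0`): by K-B1′ `y₂ = c • w⋆`, and `c ≠ 0` would make `c⁻¹ • y₁` a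
chain vector forbidden by K-B2′. Iterating, the generalised kernel of the pencil at `lam` is `span{w⋆}`
— no compactness / finite-dimensionality is used. [folklore] -/
theorem pencil_chain_eq_zero (hws : N ws + lam • J ws = 0)
    (hinj : ∀ (y : E) (μ : 𝕜), N y + lam • J y + μ • J ws = 0 → φ y = 0 → y = 0 ∧ μ = 0)
    (y₁ y₂ : E) (h1 : N y₁ + lam • J y₁ = J y₂) (h2 : N y₂ + lam • J y₂ = 0) : y₂ = 0 := by
  have hy₂ := pencil_eq_smul N J φ ws lam hws hinj y₂ h2
  set c : 𝕜 := φ y₂ / φ ws with hc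
  by_cases hc0 : c = 0
  · rw [hy₂, hc0, zero_smul]
  · exfalso
    refine pencil_ne_base N J φ ws lam hws hinj (c⁻¹ • y₁) ?_
    rw [map_smul, map_smul, smul_comm lam c⁻¹, ← smul_add, h1, hy₂, map_smul, smul_smul,
      inv_mul_cancel₀ hc0, one_smul]

/-- **K-B3′ (isolation step, pencil form).** If `R_λ w⋆ = 0`, `z ≠ lam`, and the bordered pencil map
AT `z` (same `J w⋆`, same `φ`) is injective, then `R_z` is injective: `R_z y = 0 → y = 0`. [folklore] -/
theorem pencil_eq_zero_of_ne (hws : N ws + lam • J ws = 0) (hz : z ≠ lam)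
    (hinj : ∀ (y : E) (μ : 𝕜), N y + z • J y + μ • J ws = 0 → φ y = 0 → y = 0 ∧ μ = 0)
    (y : E) (hy : N y + z • J y = 0) : y = 0 := by
  -- `R_z w⋆ = (z - lam) • J w⋆`
  have hRz : N ws + z • J ws = (z - lam) • J ws := by
    rw [eq_neg_of_add_eq_zero_left hws, sub_smul]; abel
  -- `φ w⋆ ≠ 0`: test the pair `(w⋆, lam - z)`
  have hφ : φ ws ≠ 0 := by
    intro h0
    have h := hinj ws (lam - z) (by rw [hRz, ← add_smul]; ring_nf; simp) h0
    exact hz (sub_eq_zero.mp h.2).symm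
  set c : 𝕜 := φ y / φ ws with hc
  have h1 : N (y - c • ws) + z • J (y - c • ws) + (c * (z - lam)) • J ws = 0 := by
    have : N (y - c • ws) + z • J (y - c • ws) = (N y + z • J y) - c • (N ws + z • J ws) := by
      simp only [map_sub, map_smul]
      module
    rw [this, hy, hRz, smul_smul, zero_sub, neg_add_cancel]
  have h2 : φ (y - c • ws) = 0 := by
    simp only [map_sub, map_smul, smul_eq_mul, hc]
    field_simp
    ring
  have h := hinj _ _ h1 h2
  have hc0 : c = 0 := by
    rcases mul_eq_zero.mp h.2 with h0 | h0
    · exact h0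
    · exact absurd (sub_eq_zero.mp h0) hz
  have h3 := h.1
  rwa [hc0, zero_smul, sub_zero] at h3

/-- **K-B5′ (fixed points of the bordered Newton map are the eigenpairs, pencil form).** With the
float datum `(λ̃, w̃) = (lt, wt)` (residual `r = R_λ̃ w̃`, bordering vector `ṽ = J w̃`) and a candidate
`(l, w)`, the bordered equation «`R_λ̃ (w̃ − w) + (λ̃ − l) • J w̃ = r + (l − λ̃) • (J w − J w̃)`» holds
iff `R_l w = 0`, i.e. `N w + l • J w = 0` (the two sides differ exactly by `R_l w`; the normalisation
`φ (w̃ − w) = 0 ↔ φ w = φ w̃` is separate and trivial). [folklore] -/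
theorem pencil_bordered_iff_eigen (wt w : E) (lt l : 𝕜) :
    (N (wt - w) + lt • J (wt - w) + (lt - l) • J wt =
        (N wt + lt • J wt) + (l - lt) • (J w - J wt)) ↔ N w + l • J w = 0 := by
  have key : (N (wt - w) + lt • J (wt - w) + (lt - l) • J wt) -
      ((N wt + lt • J wt) + (l - lt) • (J w - J wt)) = -(N w + l • J w) := by
    simp only [map_sub, smul_sub, sub_smul]
    abel
  constructor
  · intro h
    have h' := sub_eq_zero.mpr h
    rw [key, neg_eq_zero] at h'
    exact h'
  · intro h
    have : (N (wt - w) + lt • J (wt - w) + (lt - l) • J wt) -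
        ((N wt + lt • J wt) + (l - lt) • (J w - J wt)) = 0 := by rw [key, h, neg_zero]
    exact sub_eq_zero.mp this

end Pencil

/-! ## §2 Analytic assembly: transfer of the a-priori bound, simplicity, isolation -/

section Analytic

variable {𝕜 H : Type*} [RCLike 𝕜] [NormedAddCommGroup H] [InnerProductSpace 𝕜 H]

/-- The resolvent-coordinate operator is the pencil: `(1 − T − (x₀ − z)•S₀) y = N y + z • S₀ y` with
`N = 1 − T − x₀•S₀`. -/
theorem resolventCoord_apply (S₀ T : H →L[𝕜] H) (x₀ z : 𝕜) (y : H) :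
    ((1 : H →L[𝕜] H) - T - (x₀ - z) • S₀) y =
      ((1 : H →L[𝕜] H) - T - x₀ • S₀) y + z • S₀ y := by
  simp only [FunLike.coe_sub, FunLike.coe_smul, Pi.sub_apply,
    Pi.smul_apply, sub_smul]
  abel

omit [InnerProductSpace 𝕜 H] in
/-- Cauchy–Schwarz in the plane, the form used for the perturbation size:
`a‖p‖ + ‖μ‖ b ≤ ρ ‖(p, μ)‖` when `a² + b² ≤ ρ²` (`a, b, ρ ≥ 0`). [folklore] -/
theorem mul_norm_add_norm_mul_le (p : H) (μ : 𝕜) {a b ρ : ℝ} (ha : 0 ≤ a) (hb : 0 ≤ b)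
    (hρ : 0 ≤ ρ) (h : a ^ 2 + b ^ 2 ≤ ρ ^ 2) :
    a * ‖p‖ + ‖μ‖ * b ≤ ρ * ‖WithLp.toLp 2 (p, μ)‖ := by
  have hn : ‖WithLp.toLp 2 (p, μ)‖ ^ 2 = ‖p‖ ^ 2 + ‖μ‖ ^ 2 :=
    BorderedHeadTailBound.norm_toLp_sq p μ
  have h0 : 0 ≤ a * ‖p‖ + ‖μ‖ * b := by positivity
  have hsq : (a * ‖p‖ + ‖μ‖ * b) ^ 2 ≤ (ρ * ‖WithLp.toLp 2 (p, μ)‖) ^ 2 := by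
    rw [mul_pow, hn]
    nlinarith [sq_nonneg (a * ‖μ‖ - b * ‖p‖), sq_nonneg ‖p‖, sq_nonneg ‖μ‖,
      mul_nonneg (sub_nonneg.mpr h) (add_nonneg (sq_nonneg ‖p‖) (sq_nonneg ‖μ‖))]
  exact (pow_le_pow_iff_left₀ h0 (by positivity) two_ne_zero).mp hsq

/-- **Transfer of the a-priori bound to the certified pair (3-B (c), first step).** Suppose the
a-priori bound at the float pair, `‖(S₀ y, μ)‖ ≤ M‖(R_λ̃ y + μ ṽ, ⟪ṽ, S₀ y⟫)‖` (3-B (a)), and a pair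
`(λ⋆, w⋆)` with `‖S₀ w⋆ − ṽ‖² + |λ⋆ − λ̃|² ≤ ρ²` (the K-B4 ball) and `Mρ < 1`. Then the bordered map at
the certified pair, `(y, μ) ↦ (R_λ⋆ y + μ S₀w⋆, ⟪ṽ, S₀ y⟫)`, obeys the same bound with
`M⋆ = M/(1 − Mρ)`: its difference from the float one is `((λ⋆ − λ̃)S₀ y + μ(S₀w⋆ − ṽ), 0)`, of norm
`≤ ρ‖(S₀ y, μ)‖` by Cauchy–Schwarz. [folklore] -/
theorem apriori_bound_at_certified (S₀ T : H →L[𝕜] H) (x₀ lt lam : 𝕜) (vt ws : H) {M ρ : ℝ}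
    (hM : 0 ≤ M) (hρ : 0 ≤ ρ) (hMρ : M * ρ < 1)
    (hapr : ∀ (y : H) (μ : 𝕜), ‖WithLp.toLp 2 (S₀ y, μ)‖ ≤
      M * ‖WithLp.toLp 2 (((1 : H →L[𝕜] H) - T - (x₀ - lt) • S₀) y + μ • vt, ⟪vt, S₀ y⟫_𝕜)‖)
    (hball : ‖S₀ ws - vt‖ ^ 2 + ‖lam - lt‖ ^ 2 ≤ ρ ^ 2) (y : H) (μ : 𝕜) :
    ‖WithLp.toLp 2 (S₀ y, μ)‖ ≤ M / (1 - M * ρ) *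
      ‖WithLp.toLp 2 (((1 : H →L[𝕜] H) - T - (x₀ - lam) • S₀) y + μ • S₀ ws, ⟪vt, S₀ y⟫_𝕜)‖ := by
  refine BorderedHeadTailBound.apriori_bound_of_perturbation
    (fun x : H × 𝕜 => WithLp.toLp 2 (S₀ x.1, x.2))
    (fun x : H × 𝕜 => WithLp.toLp 2
      (((1 : H →L[𝕜] H) - T - (x₀ - lt) • S₀) x.1 + x.2 • vt, ⟪vt, S₀ x.1⟫_𝕜))
    (fun x : H × 𝕜 => WithLp.toLp 2
      (((1 : H →L[𝕜] H) - T - (x₀ - lam) • S₀) x.1 + x.2 • S₀ ws, ⟪vt, S₀ x.1⟫_𝕜))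
    hM (fun x => hapr x.1 x.2) (fun x => ?_) hMρ (y, μ)
  -- the perturbation: `((lam - lt) • S₀ y + μ • (S₀ ws - vt), 0)`
  have hdiff : WithLp.toLp 2 (((1 : H →L[𝕜] H) - T - (x₀ - lam) • S₀) x.1 + x.2 • S₀ ws,
        ⟪vt, S₀ x.1⟫_𝕜) -
      WithLp.toLp 2 (((1 : H →L[𝕜] H) - T - (x₀ - lt) • S₀) x.1 + x.2 • vt, ⟪vt, S₀ x.1⟫_𝕜) =
      WithLp.toLp 2 ((lam - lt) • S₀ x.1 + x.2 • (S₀ ws - vt), (0 : 𝕜)) := by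
    rw [← WithLp.toLp_sub, Prod.mk_sub_mk, sub_self, resolventCoord_apply S₀ T x₀ lam,
      resolventCoord_apply S₀ T x₀ lt]
    congr 2
    rw [smul_sub, sub_smul]
    abel
  rw [hdiff, WithLp.norm_toLp_fst]
  calc ‖(lam - lt) • S₀ x.1 + x.2 • (S₀ ws - vt)‖
      ≤ ‖lam - lt‖ * ‖S₀ x.1‖ + ‖x.2‖ * ‖S₀ ws - vt‖ := by
        refine (norm_add_le _ _).trans ?_
        rw [norm_smul, norm_smul]
    _ ≤ ρ * ‖WithLp.toLp 2 (S₀ x.1, x.2)‖ :=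
        mul_norm_add_norm_mul_le (S₀ x.1) x.2 (norm_nonneg _) (norm_nonneg _) hρ
          (by rw [add_comm]; exact hball)

/-- **Bordered injectivity at a nearby parameter (3-B (c)/(d), second step).** An a-priori bound with
constant `M⋆` for the bordered map at `(λ⋆, S₀ w⋆)` transfers to the bordered map at ANY `z` with
`M⋆|z − λ⋆| < 1` (difference `((z − λ⋆)S₀ y, 0)`), which is therefore injective when `S₀` is — the
hypothesis of K-B1′–K-B3′ (at `z = λ⋆` included). [folklore] -/
theorem bordered_injective_at (S₀ T : H →L[𝕜] H) (hS₀ : Function.Injective S₀) (x₀ lam z : 𝕜)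
    (vt ws : H) {Ms : ℝ} (hMs : 0 ≤ Ms) (hz : Ms * ‖z - lam‖ < 1)
    (hapr : ∀ (y : H) (μ : 𝕜), ‖WithLp.toLp 2 (S₀ y, μ)‖ ≤ Ms *
      ‖WithLp.toLp 2 (((1 : H →L[𝕜] H) - T - (x₀ - lam) • S₀) y + μ • S₀ ws, ⟪vt, S₀ y⟫_𝕜)‖) :
    ∀ (y : H) (μ : 𝕜), ((1 : H →L[𝕜] H) - T - x₀ • S₀) y + z • S₀ y + μ • S₀ ws = 0 →
      ((innerₛₗ 𝕜 vt).comp S₀.toLinearMap) y = 0 → y = 0 ∧ μ = 0 := by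
  intro y μ h1 h2
  have hapr' := BorderedHeadTailBound.apriori_bound_of_perturbation
    (fun x : H × 𝕜 => WithLp.toLp 2 (S₀ x.1, x.2))
    (fun x : H × 𝕜 => WithLp.toLp 2
      (((1 : H →L[𝕜] H) - T - (x₀ - lam) • S₀) x.1 + x.2 • S₀ ws, ⟪vt, S₀ x.1⟫_𝕜))
    (fun x : H × 𝕜 => WithLp.toLp 2
      (((1 : H →L[𝕜] H) - T - (x₀ - z) • S₀) x.1 + x.2 • S₀ ws, ⟪vt, S₀ x.1⟫_𝕜))
    hMs (fun x => hapr x.1 x.2) (fun x => ?_) hz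
  · refine BorderedHeadTailBound.eq_zero_of_apriori_bound S₀ hS₀
      (fun (y : H) (μ : 𝕜) => WithLp.toLp 2
        (((1 : H →L[𝕜] H) - T - (x₀ - z) • S₀) y + μ • S₀ ws, ⟪vt, S₀ y⟫_𝕜))
      (fun y μ => hapr' (y, μ)) y μ ?_
    have h1' : ((1 : H →L[𝕜] H) - T - (x₀ - z) • S₀) y + μ • S₀ ws = 0 := by
      rw [resolventCoord_apply]; exact h1
    have h2' : ⟪vt, S₀ y⟫_𝕜 = 0 := by simpa using h2
    rw [h1', h2']
    rfl
  · have hdiff : WithLp.toLp 2 (((1 : H →L[𝕜] H) - T - (x₀ - z) • S₀) x.1 + x.2 • S₀ ws,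
          ⟪vt, S₀ x.1⟫_𝕜) -
        WithLp.toLp 2 (((1 : H →L[𝕜] H) - T - (x₀ - lam) • S₀) x.1 + x.2 • S₀ ws,
          ⟪vt, S₀ x.1⟫_𝕜) = WithLp.toLp 2 ((z - lam) • S₀ x.1, (0 : 𝕜)) := by
      rw [← WithLp.toLp_sub, Prod.mk_sub_mk, sub_self, resolventCoord_apply S₀ T x₀ z,
        resolventCoord_apply S₀ T x₀ lam]
      congr 2
      rw [sub_smul]
      abel
    rw [hdiff, WithLp.norm_toLp_fst, norm_smul]
    refine mul_le_mul_of_nonneg_left ?_ (norm_nonneg _)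
    have := BorderedHeadTailBound.norm_toLp_sq (S₀ x.1) x.2
    nlinarith [norm_nonneg (WithLp.toLp 2 (S₀ x.1, x.2)), norm_nonneg (S₀ x.1), sq_nonneg ‖x.2‖]

/-- **3-B (c) in resolvent coordinates: geometric and algebraic simplicity.** Under the a-priori bound
at the float pair (constant `M`), a certified pair `(λ⋆, w⋆)` with `R_λ⋆ w⋆ = 0` in the ball
`‖S₀w⋆ − ṽ‖² + |λ⋆ − λ̃|² ≤ ρ²`, `Mρ < 1`, and `S₀` injective: every `y` with `R_λ⋆ y = 0` is a multiple
of `w⋆`, and a chain `R_λ⋆ y₁ = S₀ y₂`, `R_λ⋆ y₂ = 0` has `y₂ = 0` — `ker(λ⋆ − L) = span{v⋆}` and no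
generalised eigenvector, for the unbounded `L` with `D(L) = range S₀`. [folklore] -/
theorem simple_of_apriori (S₀ T : H →L[𝕜] H) (hS₀ : Function.Injective S₀) (x₀ lt lam : 𝕜)
    (vt ws : H) {M ρ : ℝ} (hM : 0 ≤ M) (hρ : 0 ≤ ρ) (hMρ : M * ρ < 1)
    (hapr : ∀ (y : H) (μ : 𝕜), ‖WithLp.toLp 2 (S₀ y, μ)‖ ≤
      M * ‖WithLp.toLp 2 (((1 : H →L[𝕜] H) - T - (x₀ - lt) • S₀) y + μ • vt, ⟪vt, S₀ y⟫_𝕜)‖)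
    (hball : ‖S₀ ws - vt‖ ^ 2 + ‖lam - lt‖ ^ 2 ≤ ρ ^ 2)
    (hws : ((1 : H →L[𝕜] H) - T - (x₀ - lam) • S₀) ws = 0) :
    (∀ y : H, ((1 : H →L[𝕜] H) - T - (x₀ - lam) • S₀) y = 0 →
        y = (⟪vt, S₀ y⟫_𝕜 / ⟪vt, S₀ ws⟫_𝕜) • ws) ∧
      (∀ y₁ y₂ : H, ((1 : H →L[𝕜] H) - T - (x₀ - lam) • S₀) y₁ = S₀ y₂ →
        ((1 : H →L[𝕜] H) - T - (x₀ - lam) • S₀) y₂ = 0 → y₂ = 0) := by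
  have hMs : 0 ≤ M / (1 - M * ρ) := div_nonneg hM (sub_pos.mpr hMρ).le
  have haprs := apriori_bound_at_certified S₀ T x₀ lt lam vt ws hM hρ hMρ hapr hball
  have hinj := bordered_injective_at S₀ T hS₀ x₀ lam lam vt ws hMs
    (by rw [sub_self, norm_zero, mul_zero]; exact one_pos) haprs
  set N : H →ₗ[𝕜] H := (((1 : H →L[𝕜] H) - T - x₀ • S₀) : H →L[𝕜] H).toLinearMap with hN
  set φ : H →ₗ[𝕜] 𝕜 := (innerₛₗ 𝕜 vt).comp S₀.toLinearMap with hφ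
  have hinj' : ∀ (y : H) (μ : 𝕜), N y + lam • S₀.toLinearMap y + μ • S₀.toLinearMap ws = 0 →
      φ y = 0 → y = 0 ∧ μ = 0 := fun y μ h1 h2 => hinj y μ h1 h2
  have hws' : N ws + lam • S₀.toLinearMap ws = 0 := by
    have := hws; rw [resolventCoord_apply] at this; exact this
  refine ⟨fun y hy => ?_, fun y₁ y₂ h1 h2 => ?_⟩
  · have hy' : N y + lam • S₀.toLinearMap y = 0 := by
      rw [resolventCoord_apply] at hy; exact hy
    have := pencil_eq_smul N S₀.toLinearMap φ ws lam hws' hinj' y hy'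
    simpa [hφ] using this
  · have h1' : N y₁ + lam • S₀.toLinearMap y₁ = S₀.toLinearMap y₂ := by
      rw [resolventCoord_apply] at h1; exact h1
    have h2' : N y₂ + lam • S₀.toLinearMap y₂ = 0 := by
      rw [resolventCoord_apply] at h2; exact h2
    exact pencil_chain_eq_zero N S₀.toLinearMap φ ws lam hws' hinj' y₁ y₂ h1' h2'

/-- **3-B (d) in resolvent coordinates, injectivity: no other eigenvalue in the disc.** Under the same
hypotheses, for every `z ≠ λ⋆` with `|z − λ⋆| < (1 − Mρ)/M` the operator `R_z` is injective — `z` is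
not an eigenvalue of `L`. [folklore] -/
theorem resolventCoord_injective_of_near (S₀ T : H →L[𝕜] H) (hS₀ : Function.Injective S₀)
    (x₀ lt lam : 𝕜) (vt ws : H) {M ρ : ℝ} (hM : 0 < M) (hρ : 0 ≤ ρ) (hMρ : M * ρ < 1)
    (hapr : ∀ (y : H) (μ : 𝕜), ‖WithLp.toLp 2 (S₀ y, μ)‖ ≤
      M * ‖WithLp.toLp 2 (((1 : H →L[𝕜] H) - T - (x₀ - lt) • S₀) y + μ • vt, ⟪vt, S₀ y⟫_𝕜)‖)
    (hball : ‖S₀ ws - vt‖ ^ 2 + ‖lam - lt‖ ^ 2 ≤ ρ ^ 2)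
    (hws : ((1 : H →L[𝕜] H) - T - (x₀ - lam) • S₀) ws = 0)
    {z : 𝕜} (hz : z ≠ lam) (hnear : ‖z - lam‖ < (1 - M * ρ) / M) :
    Function.Injective ((1 : H →L[𝕜] H) - T - (x₀ - z) • S₀) := by
  have h1M : 0 < 1 - M * ρ := sub_pos.mpr hMρ
  have hMs : 0 ≤ M / (1 - M * ρ) := div_nonneg hM.le h1M.le
  have haprs := apriori_bound_at_certified S₀ T x₀ lt lam vt ws hM.le hρ hMρ hapr hball
  have hz' : M / (1 - M * ρ) * ‖z - lam‖ < 1 := by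
    rw [div_mul_eq_mul_div, div_lt_one h1M]
    calc M * ‖z - lam‖ < M * ((1 - M * ρ) / M) := mul_lt_mul_of_pos_left hnear hM
      _ = 1 - M * ρ := mul_div_cancel₀ _ hM.ne'
  have hinj := bordered_injective_at S₀ T hS₀ x₀ lam z vt ws hMs hz' haprs
  set N : H →ₗ[𝕜] H := (((1 : H →L[𝕜] H) - T - x₀ • S₀) : H →L[𝕜] H).toLinearMap with hN
  set φ : H →ₗ[𝕜] 𝕜 := (innerₛₗ 𝕜 vt).comp S₀.toLinearMap with hφ
  have hinj' : ∀ (y : H) (μ : 𝕜), N y + z • S₀.toLinearMap y + μ • S₀.toLinearMap ws = 0 →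
      φ y = 0 → y = 0 ∧ μ = 0 := fun y μ h1 h2 => hinj y μ h1 h2
  have hws' : N ws + lam • S₀.toLinearMap ws = 0 := by
    have := hws; rw [resolventCoord_apply] at this; exact this
  refine (injective_iff_map_eq_zero _).mpr fun y hy => ?_
  have hy' : N y + z • S₀.toLinearMap y = 0 := by
    rw [resolventCoord_apply] at hy; exact hy
  exact pencil_eq_zero_of_ne N S₀.toLinearMap φ ws z lam hws' hz hinj' y hy'

variable [CompleteSpace H]

/-- **3-B (d) in resolvent coordinates: ISOLATION.** With `S₀` compact and injective (free resolvent),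
`1 − T` invertible, the a-priori bound at the float pair with constant `M` (3-B (a)), a certified pair
`(λ⋆, w⋆)`, `R_λ⋆ w⋆ = 0`, in the K-B4 ball of radius `ρ` with `Mρ < 1`: for every `z ≠ λ⋆` with
`|z − λ⋆| < (1 − Mρ)/M` the operator `R_z = 1 − T − (x₀ − z)S₀` is INVERTIBLE — `z − L : D(L) → H` is a
bijection, `z ∈ ρ(L)`: `σ(L) ∩ {|z − λ⋆| < (1 − Mρ)/M} = {λ⋆}`. Injectivity by K-B3′, surjectivity by
the Fredholm alternative (`BorderedResolventFredholm.isUnit_resolventCoord_of_injective`). [folklore] -/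
theorem isUnit_resolventCoord_of_near (S₀ T : H →L[𝕜] H) (hS₀c : IsCompactOperator S₀)
    (hS₀ : Function.Injective S₀) (hT : IsUnit ((1 : H →L[𝕜] H) - T))
    (x₀ lt lam : 𝕜) (vt ws : H) {M ρ : ℝ} (hM : 0 < M) (hρ : 0 ≤ ρ) (hMρ : M * ρ < 1)
    (hapr : ∀ (y : H) (μ : 𝕜), ‖WithLp.toLp 2 (S₀ y, μ)‖ ≤
      M * ‖WithLp.toLp 2 (((1 : H →L[𝕜] H) - T - (x₀ - lt) • S₀) y + μ • vt, ⟪vt, S₀ y⟫_𝕜)‖)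
    (hball : ‖S₀ ws - vt‖ ^ 2 + ‖lam - lt‖ ^ 2 ≤ ρ ^ 2)
    (hws : ((1 : H →L[𝕜] H) - T - (x₀ - lam) • S₀) ws = 0)
    {z : 𝕜} (hz : z ≠ lam) (hnear : ‖z - lam‖ < (1 - M * ρ) / M) :
    IsUnit ((1 : H →L[𝕜] H) - T - (x₀ - z) • S₀) :=
  BorderedResolventFredholm.isUnit_resolventCoord_of_injective S₀ T hS₀c hT (x₀ - z)
    (resolventCoord_injective_of_near S₀ T hS₀ x₀ lt lam vt ws hM hρ hMρ hapr hball hws hz hnear)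

/-- **The printed isolation radius.** The certifiers print `κ = √2·M·ρ` (`= 2√2M²‖r‖`, `ρ = 2M‖r‖`)
and `r_iso = (1 − κ)/M`; since `Mρ ≤ √2Mρ = κ`, `|z − λ⋆| < r_iso` implies `|z − λ⋆| < (1 − Mρ)/M`,
so `isUnit_resolventCoord_of_near` covers the printed punctured disc: for `κ < 1`, `z ≠ λ⋆`,
`|z − λ⋆| < (1 − κ)/M` ⇒ `R_z` invertible. [folklore] -/
theorem isUnit_resolventCoord_of_lt_rIso (S₀ T : H →L[𝕜] H) (hS₀c : IsCompactOperator S₀)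
    (hS₀ : Function.Injective S₀) (hT : IsUnit ((1 : H →L[𝕜] H) - T))
    (x₀ lt lam : 𝕜) (vt ws : H) {M ρ : ℝ} (hM : 0 < M) (hρ : 0 ≤ ρ)
    (hκ : Real.sqrt 2 * M * ρ < 1)
    (hapr : ∀ (y : H) (μ : 𝕜), ‖WithLp.toLp 2 (S₀ y, μ)‖ ≤
      M * ‖WithLp.toLp 2 (((1 : H →L[𝕜] H) - T - (x₀ - lt) • S₀) y + μ • vt, ⟪vt, S₀ y⟫_𝕜)‖)
    (hball : ‖S₀ ws - vt‖ ^ 2 + ‖lam - lt‖ ^ 2 ≤ ρ ^ 2)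
    (hws : ((1 : H →L[𝕜] H) - T - (x₀ - lam) • S₀) ws = 0)
    {z : 𝕜} (hz : z ≠ lam) (hnear : ‖z - lam‖ < (1 - Real.sqrt 2 * M * ρ) / M) :
    IsUnit ((1 : H →L[𝕜] H) - T - (x₀ - z) • S₀) := by
  have h2 : (1 : ℝ) ≤ Real.sqrt 2 := Real.one_le_sqrt.mpr (by norm_num)
  have hMρ' : M * ρ ≤ Real.sqrt 2 * M * ρ := by nlinarith [mul_nonneg hM.le hρ]
  have hMρ : M * ρ < 1 := lt_of_le_of_lt hMρ' hκ
  refine isUnit_resolventCoord_of_near S₀ T hS₀c hS₀ hT x₀ lt lam vt ws hM hρ hMρ hapr hball hws hz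
    (hnear.trans_le ?_)
  exact div_le_div_of_nonneg_right (by linarith) hM.le

end Analytic

end Summit.NavierStokesRegularity.FluidComputer.BorderedResolventIsolation
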